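import Summits.ResolutionOfSingularities.ResolutionOfSingularities.Theorems.MarkedTransferCampaignW46ThreefoldsGammaFreeGlobalLadder
import Literature.AlgebraicGeometry.Resolution.RegularCentreBlowupSeqExtension
import Literature.AlgebraicGeometry.Resolution.ControlledTransformBaseChange
import Literature.AlgebraicGeometry.Resolution.SubschemeRegularStalks
import Literature.AlgebraicGeometry.Resolution.StalkIdealLemmas
import Literature.AlgebraicGeometry.Resolution.MarkedIdealsEtale
import Literature.AlgebraicGeometry.Resolution.BlowupOffCentre
import Literature.AlgebraicGeometry.Resolution.BlowupsExistence
import HarnessLib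

/-!
# [OURS · L1 W4.6 rung (ii), dimension ladder] ORDER-REDUCIBILITY IS ZARISKI-LOCAL AROUND THE ORDER-`≥ m` LOCUS
# (brick B6 of rung (ii-2) `GammaFreeGlobalOrderReductionDimLE p 2`; any dimension)

Cell res-hironaka, LADDER-RESOLUTION rung L (D-0089), slot W4.6 «restricted-regime rungs of the typed Th. 16.6 procedure»,
rung (ii) (dimension ladder, res-L1-type-o1's `…GammaFreeGlobalLadder.lean` p496755: `CampaignW46.OrderReducible I m`); seat
res-D-pv-049 AS res-L1-s46-pv-11 (holder of rung (ii-2), res-plan-2 D→L MAP v1.6 (3); plan D/res-D-pv-049/RUNG-II-2-PLAN.md).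
Host route MarkedTransfer, host item `HypersurfaceOrderReductionDimLeThree` (stmt-ResolutionOfSingularities-16156); this file
is proposed `--kind proof --supports` it `--as helper`. Everything here is OURS scheme theory over the tree's blow-up library;
nothing of H. Hironaka's manuscript [Hironaka2017] is asserted (Def. 2.4 p.6 / §2.1 p.4 «permissible» enter only through the
campaign predicate `CampaignW46.IsPermissibleBlowupSeq`, scope only). AI-written; AI review is weaker than expert review.

## What is proved

`CampaignW46.OrderReducible.of_isOpenImmersion` — **a permissible order reduction may be built on an open neighbourhood
of the bad locus and then extended to the whole scheme.** Let `X` be regular and locally Noetherian, `J` an ideal sheaf,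
`m : ℕ`, `u : V → X` an open immersion, and `Z ⊆ X` a CLOSED set inside the image of `u` containing every point of order
`≥ m` of `J`. If `(V, u^*J, m)` is order-reducible (`OrderReducible (J.comap u) m`: a sequence of permissible blowing-ups
of the WHOLE stages of `V` ending below order `m`), then so is `(X, J, m)`. The point of the lemma: the global campaign
predicate `IsPermissibleBlowupSeq` forbids LOCALISATION (no `restrict` constructor — that was the vacuity of OURS-desk #86),
yet arguments by «shrink to a neighbourhood of `Sing(J, m)` where the support is simple-normal-crossings / monomial» are
the natural end-game of the surface rung (and of `d = 3`): this file shows such shrinking costs nothing.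

MECHANISM (`IsPermissibleBlowupSeq.exists_extension_of_isOpenImmersion`, induction on the sequence over `V`; the device
of Piltant 2013 Prop. 5.1 Step 2 / Cossart–Piltant 2019 Prop. 4.6 Step 2 as kernel-checked in the tree's
`IsRegularCentreBlowupSeq.exists_extension`, WITHOUT taking closures): along the induction every stage `V_i` sits in the
corresponding stage `X_i` by an open immersion `u_i` with `u_i^* J_i = K_i` (controlled transforms commute with open base
change, `comap_controlledTransform_of_isEffectiveCartier`), every point of `X_i` of order `≥ m` lies over `Z`, and every
point over `Z` lies in the image of `u_i` (cartesian squares, `IsBlowup.isPullback_of_isOpenImmersion`, Görtz–Wedhorn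
13.91 (2)). Hence the centre `D_i ⊆ {ord K_i ≥ m}` of the next blowing up of `V_i` has image CLOSED in `X_i` (it is closed in
the image of `u_i`, an open set containing the closed set `Φ_i⁻¹ Z ⊇ u_i(D_i)`), with the same regular reduced structure
(`Scheme.isRegular_subscheme_iff` + the stalk isomorphisms of `u_i`) and the same orders (`idealOrder_comap_of_etale`) — so
blowing up `X_i` along `u_i(D_i)` is a PERMISSIBLE step of the global predicate whose restriction over `V_i` is the given
one; off the image nothing changes (`IsBlowup.idealOrder_controlledTransform_of_not_mem`).

## Sources

* O. Piltant, RACSAM 107 (2013), proof of Prop. 5.1, Step 2 (blow up the closure of the centre). [Piltant2013]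
* U. Görtz, T. Wedhorn, *Algebraic Geometry I*, 2nd ed. (2020), Prop. 13.91 (2). [GortzWedhorn2020]
* E. Bierstone, D. Grigoriev, P. Milman, J. Włodarczyk, arXiv:1206.3090, §3.2 (controlled transform under base change),
  Lemma 8.0.3 (2) (orders along étale maps). [BierstoneGrigorievMilmanWlodarczyk2011]
* H. Hironaka, ms. 2017-03-23, §2.1 p.4, Def. 2.1 p.5, Def. 2.4 p.6 — scope only, under adjudication, not cited as fact.
  [Hironaka2017]
-/

noncomputable section

set_option linter.dupNamespace false -- mandated namespace of this single-conjunct summit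

open CategoryTheory CategoryTheory.Limits AlgebraicGeometry TopologicalSpace IsLocalRing

namespace Summit.ResolutionOfSingularities.ResolutionOfSingularities.Theorems

namespace CampaignW46

open Literature.AlgebraicGeometry.Resolution
open Scheme.IdealSheafData
open Literature.AlgebraicGeometry.Hironaka2017

universe u

/-! ## Regularity of a closed subscheme lying inside an open subscheme -/

/-- **A closed subscheme lying in an open subscheme is regular as soon as its restriction is**: for an open immersion
`u : V → X` of locally Noetherian schemes and an ideal sheaf `C` on `X` with `supp C ⊆ u(V)`, if `V(u^*C) ⊆ V` is regular
then `V(C) ⊆ X` is regular (the quotient stalks agree along the stalk isomorphisms of `u`). [folklore] -/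
theorem isRegular_subscheme_of_support_subset_range {V X : Scheme.{u}} [IsLocallyNoetherian X] [IsLocallyNoetherian V]
    (u : V ⟶ X) [IsOpenImmersion u] (C : X.IdealSheafData) (hsupp : (C.support : Set X) ⊆ Set.range u)
    (hreg : Scheme.IsRegular (C.comap u).subscheme) : Scheme.IsRegular C.subscheme := by
  refine Scheme.isRegular_subscheme_of_forall C fun x hx => ?_
  obtain ⟨y, rfl⟩ := hsupp hx
  have hy : y ∈ (C.comap u).support := by
    rw [support_comap]
    exact hx
  have hq := (Scheme.isRegular_subscheme_iff (C.comap u)).mp hreg y hy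
  haveI : IsIso (u.stalkMap y) := (IsOpenImmersion.iff_isIso_stalkMap.mp inferInstance).2 y
  let e : X.presheaf.stalk (u y) ≃+* V.presheaf.stalk y := (asIso (u.stalkMap y)).commRingCatIsoToRingEquiv
  have hmap : stalkIdeal (C.comap u) y = (stalkIdeal C (u y)).map (e : _ →+* _) :=
    stalkIdeal_comap_eq_map_stalkMap u C y
  exact IsRegularLocalRing.of_ringEquiv (Ideal.quotientEquiv _ _ e hmap).symm

/-! ## Extending a permissible sequence from an open neighbourhood of the order-`≥ m` locus -/

/-- **Extension of a sequence of permissible blowing-ups from an open subscheme containing the order-`≥ m` locus.**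
`X` regular locally Noetherian, `u : V → X` an open immersion, `Z ⊆ u(V)` closed with `{x | m ≤ ord_x J} ⊆ Z`. Every
sequence of permissible blowing-ups `σ : V′ → V` for `(u^*J, m)` with last transform `K′` is the restriction of one for
`(J, m)` on `X`: there are `Φ : X′ → X`, `J′` and an open immersion `u′ : V′ → X′` with `IsPermissibleBlowupSeq J m Φ J′`,
`u′ ≫ Φ = σ ≫ u`, `u′^*J′ = K′`, every point of `X′` of order `≥ m` for `J′` lying over `Z`, and every point over `Z` in the
image of `u′`. [cite: Piltant2013, Prop. 5.1 (proof, Step 2)] [cite: GortzWedhorn2020, Prop. 13.91 (2)] -/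
theorem IsPermissibleBlowupSeq.exists_extension_of_isOpenImmersion {V X : Scheme.{u}} [IsLocallyNoetherian X]
    (hX : Scheme.IsRegular X) (u : V ⟶ X) [IsOpenImmersion u] (J : X.IdealSheafData) (m : ℕ)
    (Z : Set X) (hZ : IsClosed Z) (hJZ : ∀ x : X, (m : ℕ∞) ≤ idealOrder J x → x ∈ Z)
    (hZu : Z ⊆ Set.range u) :
    ∀ {V' : Scheme.{u}} {σ : V' ⟶ V} {K' : V'.IdealSheafData}, IsPermissibleBlowupSeq (J.comap u) m σ K' →
      ∃ (X' : Scheme.{u}) (Φ : X' ⟶ X) (J' : X'.IdealSheafData) (u' : V' ⟶ X'),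
        IsPermissibleBlowupSeq J m Φ J' ∧ IsOpenImmersion u' ∧ u' ≫ Φ = σ ≫ u ∧ K' = J'.comap u' ∧
        (∀ x' : X', (m : ℕ∞) ≤ idealOrder J' x' → Φ x' ∈ Z) ∧ (∀ x' : X', Φ x' ∈ Z → x' ∈ Set.range u') := by
  intro V' σ K' h
  induction h with
  | nil =>
    exact ⟨X, 𝟙 X, J, u, IsPermissibleBlowupSeq.nil, inferInstance, by simp, rfl,
      fun x hx => hJZ x (by simpa using hx), fun x hx => hZu (by simpa using hx)⟩
  | @blowup V₂ V₁ σ₁ K₁ hseq D π hreg hD hπ ih =>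
    obtain ⟨X₁, Φ₁, J₁, u₁, hseq₁, hu₁, hcomm₁, hK₁, ha₁, hb₁⟩ := ih
    haveI := hu₁
    obtain ⟨hN₁, hX₁⟩ := hseq₁.isLocallyNoetherian_and_isRegular inferInstance hX
    haveI := hN₁
    haveI : IsLocallyNoetherian V₁ := LocallyOfFiniteType.isLocallyNoetherian u₁
    -- orders on `V₁` are orders on `X₁`
    have hordu : ∀ y : V₁, idealOrder K₁ y = idealOrder J₁ (u₁ y) := fun y => by
      rw [hK₁]; exact idealOrder_comap_of_etale u₁ J₁ y
    -- the image of the centre is closed in `X₁`: it lies in the closed set `Φ₁⁻¹ Z ⊆ u₁(V₁)`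
    have himZ : ∀ y ∈ (D : Set V₁), Φ₁ (u₁ y) ∈ Z := fun y hy =>
      ha₁ (u₁ y) (by rw [← hordu]; exact hD y hy)
    have hcl : closure (u₁ '' (D : Set V₁)) = u₁ '' (D : Set V₁) := by
      refine Set.Subset.antisymm (fun x hx => ?_) subset_closure
      have hxZ : Φ₁ x ∈ Z := by
        have hsub : closure (u₁ '' (D : Set V₁)) ⊆ Φ₁ ⁻¹' Z :=
          closure_minimal (by rintro _ ⟨y, hy, rfl⟩; exact himZ y hy) (hZ.preimage Φ₁.continuous)
        exact hsub hx
      obtain ⟨y, rfl⟩ := hb₁ x hxZ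
      have hy : y ∈ ((closureImage u₁ (D : Set V₁)).preimage u₁.continuous : Set V₁) := hx
      rw [preimage_closureImage_eq] at hy
      exact ⟨y, hy, rfl⟩
    -- the centre on `X₁`: the reduced closed subscheme on `u₁(D)`
    set DX : Closeds X₁ := closureImage u₁ (D : Set V₁) with hDX
    have hDXcoe : (DX : Set X₁) = u₁ '' (D : Set V₁) := by rw [hDX, coe_closureImage, hcl]
    set C : X₁.IdealSheafData := vanishingIdeal DX with hCdef
    have hC : C.comap u₁ = vanishingIdeal D := comap_vanishingIdeal_closureImage u₁ D
    -- it is regular …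
    have hregX : Scheme.IsRegular (vanishingIdeal DX).subscheme := by
      refine isRegular_subscheme_of_support_subset_range u₁ C (fun x hx => ?_) (by rw [hC]; exact hreg)
      rw [hCdef, coe_support_vanishingIdeal, hDXcoe] at hx
      obtain ⟨y, -, rfl⟩ := hx
      exact ⟨y, rfl⟩
    -- … and inside the order-`≥ m` locus of `J₁`
    have hDXord : ∀ x ∈ (DX : Set X₁), (m : ℕ∞) ≤ idealOrder J₁ x := by
      intro x hx
      rw [hDXcoe] at hx
      obtain ⟨y, hy, rfl⟩ := hx
      rw [← hordu]
      exact hD y hy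
    -- blow up `X₁` along it: a permissible step of the global predicate
    obtain ⟨X₂, πX, hπX⟩ := exists_isBlowup X₁ C
    have hstep : IsPermissibleBlowupSeq J m (πX ≫ Φ₁) (controlledTransform πX (vanishingIdeal DX) J₁ m) :=
      hseq₁.blowup DX πX hregX hDXord hπX
    -- the blowing up of `V₁` maps into it as an open subscheme (GW 13.91 (2))
    have hπ' : IsBlowup π (C.comap u₁) := by rw [hC]; exact hπ
    let u₂ : V₂ ⟶ X₂ := hπX.lift (π ≫ u₁)
      (by rw [Scheme.IdealSheafData.comap_comp]; exact hπ'.isEffectiveCartier)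
    have hu₂π : u₂ ≫ πX = π ≫ u₁ := hπX.lift_comp _ _
    have hsq : IsPullback u₂ π πX u₁ := hπX.isPullback_of_isOpenImmersion u₁ hπ' hu₂π
    haveI : IsOpenImmersion u₂ := MorphismProperty.of_isPullback hsq.flip inferInstance
    obtain ⟨hN₂, -⟩ := hstep.isLocallyNoetherian_and_isRegular inferInstance hX
    haveI := hN₂
    haveI : IsLocallyNoetherian V₂ := LocallyOfFiniteType.isLocallyNoetherian u₂
    -- the controlled transforms match along `u₂` (BGMW §3.2 in families)
    have hle : J₁.comap πX ≤ C.comap πX ^ m :=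
      comap_le_comap_pow_of_le_pow (le_vanishingIdeal_pow_of_forall_le_idealOrder hX₁ hregX hDXord) πX
    have hDs : IsEffectiveCartier ((C.comap πX).comap u₂) := by
      rw [← Scheme.IdealSheafData.comap_comp, hu₂π, Scheme.IdealSheafData.comap_comp, hC]
      exact hπ.isEffectiveCartier
    have hK₂ : controlledTransform π (vanishingIdeal D) K₁ m =
        (controlledTransform πX (vanishingIdeal DX) J₁ m).comap u₂ := by
      rw [comap_controlledTransform_of_isEffectiveCartier u₁ hu₂π C J₁ m hπX.isEffectiveCartier hle hDs,
        hC, ← hK₁]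
    refine ⟨X₂, πX ≫ Φ₁, controlledTransform πX (vanishingIdeal DX) J₁ m, u₂, hstep, inferInstance,
      by rw [← Category.assoc, hu₂π, Category.assoc, hcomm₁, Category.assoc], hK₂, fun x₂ hx₂ => ?_,
      fun x₂ hx₂ => ?_⟩
    · -- points of order `≥ m` upstairs lie over `Z`
      rw [Scheme.Hom.comp_apply]
      by_cases hmem : πX x₂ ∈ (C.support : Set X₁)
      · rw [hCdef, coe_support_vanishingIdeal, hDXcoe] at hmem
        obtain ⟨y, hy, hyx⟩ := hmem
        rw [← hyx]
        exact himZ y hy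
      · rw [hπX.idealOrder_controlledTransform_of_not_mem J₁ m hmem] at hx₂
        exact ha₁ _ hx₂
    · -- points over `Z` lie in the image of `u₂ = u₁ ×_{X₁} X₂`
      rw [Scheme.Hom.comp_apply] at hx₂
      obtain ⟨y, hy⟩ := hb₁ _ hx₂
      obtain ⟨z, hz, -⟩ := Scheme.Pullback.exists_preimage_pullback x₂ y hy.symm
      refine ⟨(hsq.isoPullback).inv z, ?_⟩
      rw [← hz, ← Scheme.Hom.comp_apply, IsPullback.isoPullback_inv_fst]

/-- **[OURS · W4.6 rung (ii-2), brick B6] Order-reducibility is Zariski-local around the order-`≥ m` locus.** For a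
regular locally Noetherian scheme `X`, an ideal sheaf `J`, `m : ℕ`, an open immersion `u : V → X` and a CLOSED set
`Z ⊆ u(V)` containing `{x | m ≤ ord_x J}`: if `(V, u^*J, m)` is order-reducible by permissible blowing-ups
(`CampaignW46.OrderReducible`, res-L1-type-o1's ladder decl — replaces the role of the conclusion of the rung-(ii)
statement read on one input; NOT a statement of the manuscript), then so is `(X, J, m)`. In the surface rung this lets the
end-game shrink `X` to a neighbourhood of `Sing(J, m)` on which the support of `J` has simple normal crossings (points of
order `< m` are never blown up, and never need to be). [cite: Piltant2013, Prop. 5.1 (proof, Step 2)]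
[cite: GortzWedhorn2020, Prop. 13.91 (2)] -/
theorem OrderReducible.of_isOpenImmersion {V X : Scheme.{u}} [IsLocallyNoetherian X] (hX : Scheme.IsRegular X)
    (u : V ⟶ X) [IsOpenImmersion u] (J : X.IdealSheafData) {m : ℕ}
    (Z : Set X) (hZ : IsClosed Z) (hJZ : ∀ x : X, (m : ℕ∞) ≤ idealOrder J x → x ∈ Z) (hZu : Z ⊆ Set.range u)
    (h : OrderReducible (J.comap u) m) : OrderReducible J m := by
  obtain ⟨V', σ, K', hseq, hlt⟩ := h
  obtain ⟨X', Φ, J', u', hseq', hu', -, hK', ha', hb'⟩ :=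
    IsPermissibleBlowupSeq.exists_extension_of_isOpenImmersion hX u J m Z hZ hJZ hZu hseq
  haveI := hu'
  refine ⟨X', Φ, J', hseq', fun x' => ?_⟩
  by_contra hge
  rw [not_lt] at hge
  obtain ⟨y, rfl⟩ := hb' x' (ha' x' hge)
  have hy := hlt y
  rw [hK', idealOrder_comap_of_etale u' J' y] at hy
  exact (lt_irrefl _) (hy.trans_le hge)

/-- The same for an open SUBSCHEME `U ⊆ X` (`u = U.ι`, image `U`): if `Z ⊆ U` is closed, contains the order-`≥ m` locus of
`J`, and `(U, J|_U, m)` is order-reducible, then `(X, J, m)` is order-reducible. [cite: Piltant2013, Prop. 5.1 (proof, Step 2)] -/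
theorem OrderReducible.of_opens {X : Scheme.{u}} [IsLocallyNoetherian X] (hX : Scheme.IsRegular X) (U : X.Opens)
    (J : X.IdealSheafData) {m : ℕ} (Z : Set X) (hZ : IsClosed Z) (hJZ : ∀ x : X, (m : ℕ∞) ≤ idealOrder J x → x ∈ Z)
    (hZU : Z ⊆ (U : Set X)) (h : OrderReducible (J.comap U.ι) m) : OrderReducible J m :=
  OrderReducible.of_isOpenImmersion hX U.ι J Z hZ hJZ (by rwa [Scheme.Opens.range_ι]) h

end CampaignW46

end Summit.ResolutionOfSingularities.ResolutionOfSingularities.Theorems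

end
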